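import Summits.Ventures.Crystal3D.Theorems.StickyWulffConstantCoaxialWallLawTwinAbsorption
import HarnessLib

/-!
# The crude absorption inequality for a twin pair, in the crux's frame (both grains)

HONEST FRAMING. Part of the venture `Summits/Ventures/Crystal3D` (cell `crystal3d-full`), helper
`--supports` the crux `CoaxialWallLaw` (stmt-Ventures-19481, `route-Ventures-StickyWulffConstant`),
REGISTERED line `WallLedgerF` (planner cf-p1 gen 16), stub `stub_coaxialTwoSlabAdhesion`
(terrace/riser slot ledger).  Rigid-motion bookkeeping around `twin_absorption_inPlane`
(`…CoaxialWallLawTwinAbsorption`): after the frame normalisation of the crux's co-axiality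
hypothesis (`coaxial_frame_eq_fcc_of_one` / `coaxial_frame_eq_fcc_of_neg_one`) the two grains of a
TWIN pair are `M·Λ₀ + t` and `(M ∘ R)·Λ₀ + t'` for a linear isometry `M` and the half-turn `R`
about `e₃`; the host grain may be either of them.

* `twin_absorption_inPlane_moved` — host `M·Λ₀ + t`, foreign `(M ∘ R)·Λ₀ + t'`: for a unit
  packing `X` on the two grains and a host site `x` off the foreign grain,
  `#{w ∈ fccSlots : w₂ = 0, x + M w ∉ X} + 4 · deg_X(x) ≤ 48`;
* `twin_absorption_inPlane_moved'` — host `(M ∘ R)·Λ₀ + t'`, foreign `M·Λ₀ + t`: the same with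
  the host's in-plane slots `x + M (R w)` (`= x − M w` for horizontal `w`).

Summing either over the balls of its grain turns the riser count of that grain
(`coaxial_inPlane_vacancies` / `_top`, the six in-plane classes `±M u, ±M v, ±M(v − u)`) into
deficiency at rate `¼`.
WHAT THIS IS NOT: coincidence sites, translation pairs, the identification of the six-term riser
sum with the `fccSlots` filter, the assembly; rung F-C1 not moved.
-/

noncomputable section

namespace Summit.Ventures.Crystal3D.Theorems

open Summit.Ventures.Crystal3D Finset
open Literature.MathematicalPhysics.StatisticalMechanics (fccStacking)

/-- **Crude absorption, twin pair, host grain `M·Λ₀ + t`, foreign grain `(M ∘ R)·Λ₀ + t'`.** -/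
theorem twin_absorption_inPlane_moved
    (M : EuclideanSpace ℝ (Fin 3) ≃ₗᵢ[ℝ] EuclideanSpace ℝ (Fin 3)) (t t' : EuclideanSpace ℝ (Fin 3))
    (X : Finset (EuclideanSpace ℝ (Fin 3)))
    (hX : ∀ p ∈ X, ∀ q ∈ X, p ≠ q → 1 ≤ dist p q)
    (hXΛ : ∀ p ∈ X, p ∈ (fun q => M q + t) '' fccStacking 1 (Real.sqrt (2 / 3)) ∨
      p ∈ (fun q => ((ℝ ∙ EuclideanSpace.single (2 : Fin 3) (1 : ℝ)).reflection.trans M) q + t') ''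
        fccStacking 1 (Real.sqrt (2 / 3)))
    (x : EuclideanSpace ℝ (Fin 3)) (hx : x ∈ (fun q => M q + t) '' fccStacking 1 (Real.sqrt (2 / 3)))
    (hx' : x ∉ (fun q => ((ℝ ∙ EuclideanSpace.single (2 : Fin 3) (1 : ℝ)).reflection.trans M) q + t') ''
        fccStacking 1 (Real.sqrt (2 / 3))) :
    (fccSlots.filter fun w => w 2 = 0 ∧ x + M w ∉ X).card +
      4 * (X.filter fun y => dist x y = 1).card ≤ 48 := by
  classical
  set R := (ℝ ∙ EuclideanSpace.single (2 : Fin 3) (1 : ℝ)).reflection with hR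
  -- pull back by `f p = M⁻¹ (p − t)`
  set f : EuclideanSpace ℝ (Fin 3) → EuclideanSpace ℝ (Fin 3) := fun p => M.symm (p - t) with hf
  have hfd : ∀ u w, dist (f u) (f w) = dist u w := by
    intro u w; simp only [hf]; rw [LinearIsometryEquiv.dist_map, dist_sub_right]
  have hinj : Function.Injective f := by
    intro u w huw
    have : u - t = w - t := M.symm.injective huw
    simpa using this
  have hfinv : ∀ p, f (M p + t) = p := fun p => by simp [hf]
  set s := M.symm (t' - t) with hs
  have hftwin : ∀ q, f (M (R q) + t') = R q + s := by
    intro q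
    simp only [hf, hs]
    rw [show M (R q) + t' - t = M (R q) + (t' - t) by abel, map_add, LinearIsometryEquiv.symm_apply_apply]
  set X' := X.image f with hX'
  -- the pulled-back packing lives on `Λ₀ ∪ (R·Λ₀ + s)`
  have hX'pack : ∀ p ∈ X', ∀ q ∈ X', p ≠ q → 1 ≤ dist p q := by
    intro p hp q hq hpq
    obtain ⟨p₀, hp₀, rfl⟩ := mem_image.1 hp
    obtain ⟨q₀, hq₀, rfl⟩ := mem_image.1 hq
    rw [hfd]
    exact hX p₀ hp₀ q₀ hq₀ fun e => hpq (by rw [e])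
  have hX'Λ : ∀ p ∈ X', p ∈ fccStacking 1 (Real.sqrt (2 / 3)) ∨
      p ∈ (fun q => R q + s) '' fccStacking 1 (Real.sqrt (2 / 3)) := by
    intro p hp
    obtain ⟨p₀, hp₀, rfl⟩ := mem_image.1 hp
    rcases hXΛ p₀ hp₀ with ⟨q, hq, hq'⟩ | ⟨q, hq, hq'⟩
    · left; rw [← hq', hfinv]; exact hq
    · right
      refine ⟨q, hq, ?_⟩
      rw [← hq']
      exact (hftwin q).symm
  obtain ⟨x₀, hx₀, hx₀'⟩ := hx
  have hfx : f x = x₀ := by rw [← hx₀', hfinv]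
  have hfxΛ : f x ∈ fccStacking 1 (Real.sqrt (2 / 3)) := by rw [hfx]; exact hx₀
  have hfxs : f x ∉ (fun q => R q + s) '' fccStacking 1 (Real.sqrt (2 / 3)) := by
    rintro ⟨q, hq, hq'⟩
    apply hx'
    refine ⟨q, hq, ?_⟩
    apply hinj
    show f (M (R q) + t') = f x
    exact (hftwin q).trans hq'
  have key := twin_absorption_inPlane s X' hX'pack hX'Λ (f x) hfxΛ hfxs
  -- translate the two counts back
  have hdeg : (X'.filter fun y => dist (f x) y = 1).card = (X.filter fun y => dist x y = 1).card := by
    rw [hX', filter_image, card_image_of_injective _ hinj]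
    congr 1
    exact filter_congr fun y _ => by simp [hfd]
  have hslot : (fccSlots.filter fun w => w 2 = 0 ∧ f x + w ∉ X') =
      fccSlots.filter fun w => w 2 = 0 ∧ x + M w ∉ X := by
    refine filter_congr fun w _ => ?_
    have hfw : f (x + M w) = f x + w := by
      simp only [hf]
      rw [show x + M w - t = (x - t) + M w by abel, map_add, LinearIsometryEquiv.symm_apply_apply]
    rw [← hfw, hX', Function.Injective.mem_finset_image hinj]
  rw [hdeg, hslot] at key
  exact key

/-- **Crude absorption, twin pair, host grain `(M ∘ R)·Λ₀ + t'`, foreign grain `M·Λ₀ + t`.**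
The host's slot vectors are `M (R w)`; for the six horizontal slots `R w = −w`. -/
theorem twin_absorption_inPlane_moved'
    (M : EuclideanSpace ℝ (Fin 3) ≃ₗᵢ[ℝ] EuclideanSpace ℝ (Fin 3)) (t t' : EuclideanSpace ℝ (Fin 3))
    (X : Finset (EuclideanSpace ℝ (Fin 3)))
    (hX : ∀ p ∈ X, ∀ q ∈ X, p ≠ q → 1 ≤ dist p q)
    (hXΛ : ∀ p ∈ X, p ∈ (fun q => M q + t) '' fccStacking 1 (Real.sqrt (2 / 3)) ∨
      p ∈ (fun q => ((ℝ ∙ EuclideanSpace.single (2 : Fin 3) (1 : ℝ)).reflection.trans M) q + t') ''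
        fccStacking 1 (Real.sqrt (2 / 3)))
    (x : EuclideanSpace ℝ (Fin 3))
    (hx : x ∈ (fun q => ((ℝ ∙ EuclideanSpace.single (2 : Fin 3) (1 : ℝ)).reflection.trans M) q + t') ''
        fccStacking 1 (Real.sqrt (2 / 3)))
    (hx' : x ∉ (fun q => M q + t) '' fccStacking 1 (Real.sqrt (2 / 3))) :
    (fccSlots.filter fun w => w 2 = 0 ∧
        x + M ((ℝ ∙ EuclideanSpace.single (2 : Fin 3) (1 : ℝ)).reflection w) ∉ X).card +
      4 * (X.filter fun y => dist x y = 1).card ≤ 48 := by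
  set R := (ℝ ∙ EuclideanSpace.single (2 : Fin 3) (1 : ℝ)).reflection with hR
  -- `(M ∘ R) ∘ R = M`
  have hRR : ∀ q, (R.trans (R.trans M)) q = M q := by
    intro q
    simp only [LinearIsometryEquiv.trans_apply, hR, Submodule.reflection_reflection]
  have hset : (fun q => (R.trans (R.trans M)) q + t) '' fccStacking 1 (Real.sqrt (2 / 3)) =
      (fun q => M q + t) '' fccStacking 1 (Real.sqrt (2 / 3)) := by
    apply Set.image_congr
    intro q _
    rw [hRR]
  have key := twin_absorption_inPlane_moved (R.trans M) t' t X hX (fun p hp => by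
      rw [hset]; exact (hXΛ p hp).symm) x hx (by rw [hset]; exact hx')
  simpa only [LinearIsometryEquiv.trans_apply] using key

end Summit.Ventures.Crystal3D.Theorems

end
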